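import Mathlib
import Summits.Ventures.PercRepro2.K5K3Transfer

/-!
# THE TYPED PARALLEL RULE: MERGING A PARALLEL PAIR OF TYPED EDGES
(blind cell PercRepro2, typer-1 g10; lead g26 04:03:50Z (3) «the kernel theorem must carry the adjoined-object
tables for parallels», mine-1 §23.11)

For a kernel `K` that cannot distinguish a parallel pair `e, e'` from the single edge `e` carrying their
`or` (`mergeT`), the typed count with the pair is a nonnegative combination of typed counts with the pair
merged into `e` of type `t`:

  `typedCount F false τ K = Σ_{t < 4} c(τ e, τ e', t) · typedCount (F.erase e') false (τ[e ↦ t]) K`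

with the merge coefficients `c(a, a', t) = #{(p, q) : |p| = a, |q| = a', p ∨ q = v}` for any copy vector `v`
of weight `t` (`fib_eq_mergeCoef`, a kernel `decide` over the `4 × 4 × 8` cases): `c(1,1,·) = (0, 1, 2, 0)`,
`c(1,2,·) = (0, 0, 2, 3)`, `c(2,2,·) = (0, 0, 1, 6)`, `c(3,t,3) = C(3,t)` — mine-1's typed parallel rule
`(1,1) = N(e(1)) + 2N(e(2))`, `(1,2) = 2N(e(2)) + 3N(e(3))`, `(2,2) = N(e(2)) + 6N(e(3))`, `(3,t) = 3N(e(3))`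
(`mergeCoef_table`).  `typedCount_merge` is the identity; the bijection of typed triples is explicit
(`T ↦ (mergeT T, (vec T e, vec T e'))`, inverse `(T', (p, q)) ↦ T'[e ↦ p][e' ↦ q]`).  `K5K3Multi.lean`
applies it to `K₃` (invariant under `mergeT` because the open graph is) by induction on `#F`.
-/

namespace Summit.Ventures.PercRepro2

namespace K5

/-! ## Copy vectors and the merge coefficients -/

section Vectors

/-- A copy vector: the states of one edge in the three copies. -/
abbrev Vec3 := Bool × Bool × Bool

/-- The weight of a copy vector (the number of open copies). -/
def wt (p : Vec3) : ℕ := p.1.toNat + p.2.1.toNat + p.2.2.toNat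

/-- Componentwise `or`. -/
def orv (p q : Vec3) : Vec3 := (p.1 || q.1, p.2.1 || q.2.1, p.2.2 || q.2.2)

/-- The number of pairs of copy vectors of weights `a, a'` with a given `or`. -/
def fib (a a' : ℕ) (v : Vec3) : ℕ :=
  (Finset.univ.filter fun pq : Vec3 × Vec3 => wt pq.1 = a ∧ wt pq.2 = a' ∧ orv pq.1 pq.2 = v).card

/-- A canonical copy vector of weight `t` (`t ≤ 3`). -/
def canon : ℕ → Vec3
  | 0 => (false, false, false)
  | 1 => (true, false, false)
  | 2 => (true, true, false)
  | _ => (true, true, true)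

/-- **The merge coefficient** `c(a, a', t)`: the number of pairs of copy vectors of weights `a, a'` whose `or`
is a given vector of weight `t`. -/
def mergeCoef (a a' t : ℕ) : ℕ := fib a a' (canon t)

/-- A copy vector has weight `≤ 3`. -/
lemma wt_le (p : Vec3) : wt p ≤ 3 := by
  unfold wt
  have := Bool.toNat_le p.1
  have := Bool.toNat_le p.2.1
  have := Bool.toNat_le p.2.2
  omega

/-- No pair has a weight above `3`. -/
lemma fib_eq_zero_of_lt (a a' : ℕ) (v : Vec3) (h : 3 < a ∨ 3 < a') : fib a a' v = 0 := by
  unfold fib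
  rw [Finset.card_eq_zero, Finset.filter_eq_empty_iff]
  intro pq _ hpq
  have := wt_le pq.1
  have := wt_le pq.2
  omega

set_option maxRecDepth 10000 in
/-- The fibre count on the small weights, checked by the kernel. -/
lemma fib_eq_mergeCoef_small : ∀ a < 4, ∀ a' < 4, ∀ v : Vec3, fib a a' v = mergeCoef a a' (wt v) := by
  decide

/-- **The fibre count depends only on the weight of the vector**: `fib a a' v = mergeCoef a a' (wt v)`. -/
lemma fib_eq_mergeCoef (a a' : ℕ) (v : Vec3) : fib a a' v = mergeCoef a a' (wt v) := by
  by_cases h : 3 < a ∨ 3 < a'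
  · unfold mergeCoef
    rw [fib_eq_zero_of_lt a a' v h, fib_eq_zero_of_lt a a' _ h]
  · rw [not_or, not_lt, not_lt] at h
    exact fib_eq_mergeCoef_small a (by omega) a' (by omega) v

/-- **The typed parallel rule's table**: `c(1,1,1) = 1`, `c(1,1,2) = 2`, `c(1,2,2) = 2`, `c(1,2,3) = 3`,
`c(2,2,2) = 1`, `c(2,2,3) = 6`, `c(3,1,3) = c(3,2,3) = 3`, `c(3,3,3) = 1`, and `c(1,1,0) = c(1,1,3) = 0`. -/
lemma mergeCoef_table :
    mergeCoef 1 1 1 = 1 ∧ mergeCoef 1 1 2 = 2 ∧ mergeCoef 1 2 2 = 2 ∧ mergeCoef 1 2 3 = 3 ∧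
      mergeCoef 2 2 2 = 1 ∧ mergeCoef 2 2 3 = 6 ∧ mergeCoef 3 1 3 = 3 ∧ mergeCoef 3 2 3 = 3 ∧
      mergeCoef 3 3 3 = 1 ∧ mergeCoef 1 1 0 = 0 ∧ mergeCoef 1 1 3 = 0 := by
  decide

end Vectors

/-! ## Triples, updates and the merge -/

section Triples

variable {E : Type*} [DecidableEq E]

/-- A triple of configurations. -/
abbrev Tri (E : Type*) := Config E × Config E × Config E

/-- The copy vector of a triple at an edge. -/
def vec (T : Tri E) (e : E) : Vec3 := (T.1 e, T.2.1 e, T.2.2 e)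

/-- Updating a triple at an edge. -/
def upd (T : Tri E) (e : E) (p : Vec3) : Tri E :=
  (Function.update T.1 e p.1, Function.update T.2.1 e p.2.1, Function.update T.2.2 e p.2.2)

/-- The merge of the edge `e'` into `e`: `e` takes the `or` of the two copy vectors, `e'` is closed. -/
def mergeT (e e' : E) (T : Tri E) : Tri E :=
  upd (upd T e (orv (vec T e) (vec T e'))) e' (false, false, false)

/-- The copy vector after an update at the updated edge. -/
lemma vec_upd_self (T : Tri E) (e : E) (p : Vec3) : vec (upd T e p) e = p := by
  simp [vec, upd]

/-- The copy vector after an update at another edge. -/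
lemma vec_upd_of_ne (T : Tri E) {e g : E} (h : g ≠ e) (p : Vec3) : vec (upd T e p) g = vec T g := by
  simp [vec, upd, Function.update_of_ne h]

omit [DecidableEq E] in
/-- Two triples with the same copy vectors everywhere are equal. -/
lemma tri_ext {T T' : Tri E} (h : ∀ g, vec T g = vec T' g) : T = T' := by
  refine Prod.ext (funext fun g => ?_) (Prod.ext (funext fun g => ?_) (funext fun g => ?_))
  · exact congrArg Prod.fst (h g)
  · exact congrArg (fun p : Vec3 => p.2.1) (h g)
  · exact congrArg (fun p : Vec3 => p.2.2) (h g)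

/-- The merged triple at `e`: the `or` of the two copy vectors. -/
lemma vec_mergeT_self {e e' : E} (hne : e ≠ e') (T : Tri E) :
    vec (mergeT e e' T) e = orv (vec T e) (vec T e') := by
  unfold mergeT
  rw [vec_upd_of_ne _ hne, vec_upd_self]

/-- The merged triple at `e'`: closed. -/
lemma vec_mergeT_e' (e e' : E) (T : Tri E) : vec (mergeT e e' T) e' = (false, false, false) := by
  unfold mergeT
  rw [vec_upd_self]

/-- The merged triple away from `e, e'`: unchanged. -/
lemma vec_mergeT_of_ne {e e' g : E} (hg : g ≠ e) (hg' : g ≠ e') (T : Tri E) :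
    vec (mergeT e e' T) g = vec T g := by
  unfold mergeT
  rw [vec_upd_of_ne _ hg', vec_upd_of_ne _ hg]

omit [DecidableEq E] in
/-- The open count is the weight of the copy vector. -/
lemma openCount_eq_wt (T : Tri E) (g : E) : openCount T.1 T.2.1 T.2.2 g = wt (vec T g) := rfl

end Triples

/-! ## The typed triples -/

section Typed

variable {E : Type*} [Fintype E] [DecidableEq E] {R : Type*} [CommRing R]

/-- The typed triples of `(F, z ≡ false, τ)`: closed off `F`, with the prescribed weights on `F`. -/
def Typed (F : Finset E) (τ : E → ℕ) (T : Tri E) : Prop :=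
  (∀ g, g ∉ F → vec T g = (false, false, false)) ∧ ∀ g ∈ F, wt (vec T g) = τ g

/-- Typedness is decidable. -/
instance (F : Finset E) (τ : E → ℕ) (T : Tri E) : Decidable (Typed F τ T) := by
  unfold Typed; infer_instance

omit [Fintype E] [DecidableEq E] in
/-- The three closedness conditions as one copy-vector equation. -/
lemma closed_iff_vec (T : Tri E) (g : E) :
    (T.1 g = false ∧ T.2.1 g = false ∧ T.2.2 g = false) ↔ vec T g = (false, false, false) := by
  simp [vec]

/-- A typed count as a sum over the typed triples. -/
lemma typedCount_eq_sum_Typed (F : Finset E) (τ : E → ℕ) (K : Config E → Config E → Config E → R) :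
    typedCount F (fun _ => false) τ K = ∑ T : Tri E, if Typed F τ T then K T.1 T.2.1 T.2.2 else 0 := by
  unfold typedCount Typed
  simp only [Fintype.sum_prod_type]
  refine Finset.sum_congr rfl fun x _ => Finset.sum_congr rfl fun y _ =>
    Finset.sum_congr rfl fun w _ => ?_
  simp only [vec, wt, openCount, Prod.mk.injEq]
  split_ifs <;> rfl

/-- The residual typed condition after the merge: closed off `F.erase e'`, the weights of `τ` on
`(F.erase e').erase e`, the edge `e` free. -/
def TypedM (F : Finset E) (τ : E → ℕ) (e e' : E) (T : Tri E) : Prop :=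
  (∀ g, g ∉ F.erase e' → vec T g = (false, false, false)) ∧
    ∀ g ∈ (F.erase e').erase e, wt (vec T g) = τ g

/-- The residual condition is decidable. -/
instance (F : Finset E) (τ : E → ℕ) (e e' : E) (T : Tri E) : Decidable (TypedM F τ e e' T) := by
  unfold TypedM; infer_instance

omit [Fintype E] in
/-- Being typed for `(F.erase e', τ[e ↦ t])` is the residual condition with weight `t` at `e`. -/
lemma typed_erase_iff (F : Finset E) (τ : E → ℕ) {e e' : E} (he : e ∈ F) (hne : e ≠ e') (t : ℕ)
    (T : Tri E) :
    Typed (F.erase e') (Function.update τ e t) T ↔ TypedM F τ e e' T ∧ wt (vec T e) = t := by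
  unfold Typed TypedM
  constructor
  · rintro ⟨h1, h2⟩
    refine ⟨⟨h1, fun g hg => ?_⟩, ?_⟩
    · rw [Finset.mem_erase] at hg
      have := h2 g hg.2
      rwa [Function.update_of_ne hg.1] at this
    · have := h2 e (Finset.mem_erase.2 ⟨hne, he⟩)
      rwa [Function.update_self] at this
  · rintro ⟨⟨h1, h2⟩, h3⟩
    refine ⟨h1, fun g hg => ?_⟩
    by_cases hge : g = e
    · subst hge
      rw [Function.update_self]
      exact h3
    · rw [Function.update_of_ne hge]
      exact h2 g (Finset.mem_erase.2 ⟨hge, hg⟩)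

end Typed

/-! ## The merge identity -/

section Merge

variable {E : Type*} [Fintype E] [DecidableEq E] {R : Type*} [CommRing R]

omit [Fintype E] in
/-- The merge of a typed triple is a residual triple with the right copy vectors at `e, e'`. -/
lemma mergeT_typed {F : Finset E} {τ : E → ℕ} {e e' : E} (he : e ∈ F) (he' : e' ∈ F) (hne : e ≠ e')
    {T : Tri E} (hT : Typed F τ T) :
    TypedM F τ e e' (mergeT e e' T) ∧ wt (vec T e) = τ e ∧ wt (vec T e') = τ e' ∧
      orv (vec T e) (vec T e') = vec (mergeT e e' T) e := by
  obtain ⟨h1, h2⟩ := hT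
  refine ⟨⟨fun g hg => ?_, fun g hg => ?_⟩, h2 e he, h2 e' he', (vec_mergeT_self hne T).symm⟩
  · by_cases hg' : g = e'
    · subst hg'
      exact vec_mergeT_e' e g T
    · have hgF : g ∉ F := fun hgF => hg (Finset.mem_erase.2 ⟨hg', hgF⟩)
      have hge : g ≠ e := fun h => hgF (h ▸ he)
      rw [vec_mergeT_of_ne hge hg', h1 g hgF]
  · rw [Finset.mem_erase, Finset.mem_erase] at hg
    rw [vec_mergeT_of_ne hg.1 hg.2.1]
    exact h2 g hg.2.2

omit [Fintype E] in
/-- The inverse of the merge: put the copy vectors `p, q` back at `e, e'`. -/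
lemma typed_upd {F : Finset E} {τ : E → ℕ} {e e' : E} (he : e ∈ F) (he' : e' ∈ F) (hne : e ≠ e')
    {T' : Tri E} (hT' : TypedM F τ e e' T') {p q : Vec3} (hp : wt p = τ e) (hq : wt q = τ e')
    (hpq : orv p q = vec T' e) :
    Typed F τ (upd (upd T' e p) e' q) ∧ mergeT e e' (upd (upd T' e p) e' q) = T' ∧
      vec (upd (upd T' e p) e' q) e = p ∧ vec (upd (upd T' e p) e' q) e' = q := by
  obtain ⟨h1, h2⟩ := hT'
  have ve : vec (upd (upd T' e p) e' q) e = p := by rw [vec_upd_of_ne _ hne, vec_upd_self]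
  have ve' : vec (upd (upd T' e p) e' q) e' = q := vec_upd_self _ _ _
  have vg : ∀ g, g ≠ e → g ≠ e' → vec (upd (upd T' e p) e' q) g = vec T' g := fun g hg hg' => by
    rw [vec_upd_of_ne _ hg', vec_upd_of_ne _ hg]
  refine ⟨⟨fun g hg => ?_, fun g hg => ?_⟩, ?_, ve, ve'⟩
  · have hge : g ≠ e := fun h => hg (h ▸ he)
    have hge' : g ≠ e' := fun h => hg (h ▸ he')
    rw [vg g hge hge']
    exact h1 g fun h => hg (Finset.mem_erase.1 h).2
  · by_cases hge : g = e
    · subst hge; rw [ve]; exact hp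
    · by_cases hge' : g = e'
      · subst hge'; rw [ve']; exact hq
      · rw [vg g hge hge']
        exact h2 g (Finset.mem_erase.2 ⟨hge, Finset.mem_erase.2 ⟨hge', hg⟩⟩)
  · refine tri_ext fun g => ?_
    by_cases hge : g = e
    · subst hge
      rw [vec_mergeT_self hne, ve, ve', hpq]
    · by_cases hge' : g = e'
      · subst hge'
        rw [vec_mergeT_e', h1 g (fun h => (Finset.mem_erase.1 h).1 rfl)]
      · rw [vec_mergeT_of_ne hge hge', vg g hge hge']

/-- **The typed parallel rule**: for a kernel invariant under the merge of `e'` into `e`,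
`typedCount F false τ K = Σ_{t < 4} c(τ e, τ e', t) · typedCount (F.erase e') false (τ[e ↦ t]) K`. -/
theorem typedCount_merge (F : Finset E) (τ : E → ℕ) (K : Config E → Config E → Config E → R)
    {e e' : E} (he : e ∈ F) (he' : e' ∈ F) (hne : e ≠ e')
    (hK : ∀ T : Tri E, K T.1 T.2.1 T.2.2 = K (mergeT e e' T).1 (mergeT e e' T).2.1 (mergeT e e' T).2.2) :
    typedCount F (fun _ => false) τ K =
      ∑ t ∈ Finset.range 4, (mergeCoef (τ e) (τ e') t : R) *
        typedCount (F.erase e') (fun _ => false) (Function.update τ e t) K := by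
  -- the left side as a double sum over residual triples and pairs of copy vectors
  have hL : typedCount F (fun _ => false) τ K =
      ∑ T' : Tri E, ∑ pq : Vec3 × Vec3,
        if TypedM F τ e e' T' ∧ wt pq.1 = τ e ∧ wt pq.2 = τ e' ∧ orv pq.1 pq.2 = vec T' e
          then K T'.1 T'.2.1 T'.2.2 else 0 := by
    rw [typedCount_eq_sum_Typed, ← Fintype.sum_prod_type']
    refine sum_ite_nbij _ _ _ _ (fun T => (mergeT e e' T, (vec T e, vec T e'))) _ _ ?_ ?_ ?_ ?_
    · intro T hT
      exact mergeT_typed he he' hne hT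
    · intro T T₂ hT hT₂ h
      simp only [Prod.mk.injEq] at h
      obtain ⟨hm, hv, hv'⟩ := h
      refine tri_ext fun g => ?_
      by_cases hge : g = e
      · subst hge; exact hv
      · by_cases hge' : g = e'
        · subst hge'; exact hv'
        · rw [← vec_mergeT_of_ne hge hge' T, ← vec_mergeT_of_ne hge hge' T₂, hm]
    · rintro ⟨T', p, q⟩ ⟨hT', hp, hq, hpq⟩
      obtain ⟨h1, h2, h3, h4⟩ := typed_upd he he' hne hT' hp hq hpq
      exact ⟨upd (upd T' e p) e' q, h1, by simp only [h2, h3, h4]⟩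
    · intro T _
      exact hK T
  -- the inner sum is the fibre count
  have hL' : ∀ T' : Tri E, (∑ pq : Vec3 × Vec3,
      if TypedM F τ e e' T' ∧ wt pq.1 = τ e ∧ wt pq.2 = τ e' ∧ orv pq.1 pq.2 = vec T' e
        then K T'.1 T'.2.1 T'.2.2 else 0) =
      if TypedM F τ e e' T' then (mergeCoef (τ e) (τ e') (wt (vec T' e)) : R) * K T'.1 T'.2.1 T'.2.2
        else 0 := by
    intro T'
    by_cases hT' : TypedM F τ e e' T'
    · rw [if_pos hT', ← fib_eq_mergeCoef]
      simp only [hT', true_and]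
      rw [← Finset.sum_filter, Finset.sum_const, nsmul_eq_mul]
      rfl
    · simp only [hT', false_and, if_false, Finset.sum_const_zero]
  -- the right side, summed over the residual triples
  have hR : ∀ T' : Tri E, (∑ t ∈ Finset.range 4, (mergeCoef (τ e) (τ e') t : R) *
      if Typed (F.erase e') (Function.update τ e t) T' then K T'.1 T'.2.1 T'.2.2 else 0) =
      if TypedM F τ e e' T' then (mergeCoef (τ e) (τ e') (wt (vec T' e)) : R) * K T'.1 T'.2.1 T'.2.2
        else 0 := by
    intro T'
    rw [Finset.sum_eq_single (wt (vec T' e))]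
    · simp only [typed_erase_iff F τ he hne, and_true]
      split_ifs <;> simp
    · intro t _ ht
      rw [if_neg, mul_zero]
      rw [typed_erase_iff F τ he hne]
      exact fun h => ht h.2.symm
    · intro h
      exact absurd (Finset.mem_range.2 (Nat.lt_succ_of_le (wt_le _))) h
  rw [hL]
  simp only [hL']
  simp only [typedCount_eq_sum_Typed, Finset.mul_sum]
  rw [Finset.sum_comm]
  exact Finset.sum_congr rfl fun T' _ => (hR T').symm

end Merge

end K5

end Summit.Ventures.PercRepro2
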